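import Literature.MathematicalPhysics.QuantumFieldTheory.Balaban1983to89.B5Eq172FlatFibreNaturality
import Literature.MathematicalPhysics.QuantumFieldTheory.Balaban1983to89.B5Eq190FlatFormTransfer

/-!
# `Balaban1983to89.B5Eq190FlatCoercivityUniform` — T. Bałaban, *Propagators and renormalization transformations for lattice gauge theories. I*,
# Commun. Math. Phys. **95** (1984) 17–40 [Balaban1984PropagatorsI] Prop. 1.1 (1.90) p. 33 with (1.69)/(1.72) pp. 29–30, FOR *Propagators for lattice
# gauge theories in a background field*, Commun. Math. Phys. **99** (1985) 389–434 [Balaban1985BackgroundPropagators] (3.26) p. 395 / Thm 3.11 p. 416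
# AT THE FLAT BACKGROUND: THE COERCIVITY CONSTANT OF THE pub-balaban NE9 CHAIN'S FLAT PRINCIPAL GAUGE-FIXED OPERATOR `D*D + D R(1) D* + aQ(1)†Q(1)`
# ON `𝔤ᶜ`-VALUED FIELDS IS `γ(d,a″)∕(ηL)²`, `a″ = a·c₁·(ηL)²∕(c₀L^d)`, `γ(d,a) = 1∕((d+1)·Cst d a)` — INDEPENDENT OF THE VOLUME `m`

statement-level skeleton of published theorems with citation tags; proofs where landed; nothing here is a claim about the Yang–Mills mass gap

PDF held: `paper:balaban1984-cmp95-propagators-rt-i` p. 33 (Prop. 1.1; p0017 of the text layer) and pp. 29–30, read by this seat (2026-08-22);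
`paper:balaban1985-cmp99-background-propagators` pp. 395, 416 via the tree's `B5Eq172FlatCoercivity` ∕ `B9Thm311SmallFieldCoercivity` docstrings.

THE PRINT (verbatim).  [B5] p. 33: *«Proposition 1.1. The operator G is a symmetric operator on L²(T_η) and ‖GJ‖, ‖∇GJ‖, ‖G∇*J‖, ‖∇G∇*J‖,
‖∇∇GJ‖, ‖G∇*∇*J‖ ≤ γ₀⁻¹‖J‖, (1.89) with a positive constant γ₀ independent of k, T_η, and depending on d only (if we put a = 1). This implies
the bound from below: Δ_a = G⁻¹ ≥ γ₀(Δ + I). (1.90)»*; p. 29 (1.69): *«⟨A, Δ_a A⟩ = ⟨A, ∂*∂A⟩ + ⟨A, ∂R∂*A⟩ + a⟨A, Q*QA⟩»*; [B9] p. 395: *«It coincides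
with Δ_a in (2.19) [of Propagators II] if U = 1»*, Thm 3.11 p. 416 (positivity of `Δ_a(U)`, «G_□(1) is positive»).

WHY THIS FILE (cell context).  The NE9 owner's fixed-lattice [B9] Thm 3.11 second half `B9Thm311SmallFieldCoercivity.exists_coercive_principal_
of_small_field` (p314868) takes its flat constant `γ₀` from `B5Eq172FlatCoercivity.exists_coercive_principal_of_near_flat` — an ∃ obtained by
COMPACTNESS (`exists_coercive_of_rePosDef`), hence a number of the volume `m`, the weight and the fibre, listed among the non-uniform constants of the
owner's thresholds.  After the leaves' volume-free letters for the other constants (`B9Eq319CentreLiftL2` ρ, `B9Eq315QFlatNorm` M_Q,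
`B9Eq323FlatBlockPoincare` μ, `B9Eq383QSemiLocal` δ_Q) this was the last one.  Here `γ₀` becomes print's (1.90): EXPLICIT and independent of `m`
(«independent of … T_η»), for every finite-dimensional Hilbert fibre `W` and algebra reading `φ : W ≃ 𝔸` — by b05's kernel-certified (1.90) on the
scalar torus carrier (`B5DeltaA169.smul_LapOne_le_DeltaA`, via the scalar transfer `B5Eq190FlatFormTransfer.flat_coercive_pullback`) and the fibre
reduction `B5Eq172FlatFibreNaturality` (every flat letter commutes with the fibre coordinates; Parseval).

WHAT IS PROVED (sorry-free; 0 `def`; (1.90) enters as the tree THEOREM `B5DeltaA169.smul_LapOne_le_DeltaA`, nothing asserted).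
* §5 **`re_inner_flat_eq_three_sq`** ((1.69) for the chain's flat operator on `V`-valued fields: `re⟨x, Δ_{1,a}(1)x⟩ = ‖D(1)x‖² + ‖R(1)D*(1)x‖² +
  a‖Q(1)x‖²`, any reading `φ`, any flat letters), **`re_inner_flat_eq_sum_coord`** (for an orthonormal basis `b` of `W`: `re⟨x, Δ_{1,a}(1)^{W,φ,𝔸}x⟩
  = Σ_k re⟨x_k, Δ_{1,a}(1)^{ℂ}x_k⟩`, `x_k = ⟨b_k, x(·)⟩`), **`coercive_of_scalar`** (a coercivity constant of the scalar flat operator is one for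
  every Hilbert fibre).
* §6 **`flat_coercive_scalar`** (`flat_coercive_pullback` on EVERY scalar bond function — each is a pull-back along the site dictionary,
  `B9Eq315FlatDictionary.torCast_bijective`), **`flat_coercive_uniform`**: for all `x : BondL2K ℂ d (L·m) c₀ W`,
  `(γ(d,a″)∕(ηL)²)·‖x‖² ≤ re⟨x, laplaceALatticeK η⁻¹ R(1) R(1⁻¹) (principalOpK φ η 1) (RofU L m φ η 1) (QtorusW L m hL φ 1 hα1 hU1 hreg) a x⟩` —
  the BODY of `B5Eq172FlatCoercivity.exists_coercive_principal_flat` with the constant DISPLAYED; `flatConst_pos`;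
  **`exists_coercive_principal_flat_uniform`** (`∃ γ > 0, ∀ m, ∀ x, …` — the volume quantified INSIDE, `α := 0`, the flat letters supplied);
  **`coercive_principal_of_near_flat_uniform`** — the shape `exists_coercive_principal_of_near_flat` consumed at the owner's (C2) with the SAME
  explicit `γ₀`: `‖(Δ_prin(U) − Δ_prin(1))x‖ ≤ δ‖x‖ ⇒ (γ₀ − δ)‖x‖² ≤ re⟨x, Δ_prin(U)x⟩` (`B5Eq172HodgePositivity.coercive_of_sub_le`).
MODEL / DECLARED READINGS.  (M1) one averaging step on the periodic lattice `TSite d (L·m)` (`n = L`), fine weight `c₀`, coarse weight `c₁`,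
scalar `η⁻¹`; b05's torus `Tor (fine L m)` under the def-free cast; print's `γ₀(Δ + I)` is used through its `I`-part only (`B5Eq190FlatFormTransfer.
b05_form_lower`), so the constant here is `γ(d, a″)` times the scaling `(ηL)⁻²` of the dictionary — volume-free, `L`-, `η`-, `d`-, `a`-,
`c₀`-, `c₁`-dependent.  (M2) no hypothesis of the papers displayed; `η ≠ 0`, `a > 0`, `1 ≤ L`; the closeness `δ` of the near-flat shape is the
DISPLAYED input as in `B5Eq172FlatCoercivity`.  (M3) NOT HERE: print's decay statements (1.89) for `G`, the multi-level operators (3.16)∕(3.24),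
[B9] (3.79)–(3.86) ∕ Thms 3.1–3.10 (the volume-uniform SMALL-FIELD step is the owner's (C2)∕(E) re-plugged with this `γ₀` — not done here),
backgrounds `U ≠ 1` beyond the near-flat shape.
HONEST SCOPE.  ONE printed inequality ([B5] (1.90), already kernel-certified on the b05 carrier) transported to the NE9 chain's typed letters for a
general Hilbert fibre; an explicit constant replaces an existential one; nothing of [B9] Thm 3.11 at `U ≠ 1` is asserted; «NE9 ⇐ the named binders»;
NOT summit progress (cell pub-balaban: NE9 NOT PRINTED ∕ NOT PROVED; spine PROVED 0/9; rung (B)+1 finite T⁴ — NOT infinite volume, NOT mass gap, NOT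
Clay; HONEST DEPENDENCY: continuum YM on T⁴ ⇐ BetaPertH ∧ nine spine estimates (0/9 proved); BetaPertH ⇐ (D1) ∧ (D4) ∧ CAP+tail; G-an2-4 gates asym,
D1 and NE2/3/4).  Unit `b2b-balaban-t4-ne9-formalise-leaf-03` (NE9 crux-team leaf prover, gen 59), INTENT I-ne9leaf03-g59-1 item (F); NEW file importing
`B5Eq172FlatFibreNaturality` + `B5Eq190FlatFormTransfer`; modifies nothing.  Net new unproved facts: 0.
-/

noncomputable section

open scoped BigOperators InnerProductSpace ComplexConjugate

namespace Literature.MathematicalPhysics.QuantumFieldTheory.Balaban1983to89.B5Eq190FlatCoercivityUniform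

open B4Sect5Torus (TSite)
open B9SectCLatticeCarrier (Bond)
open B9Eq311L2Pairing (WL2)
open B11Eq103H1Complex (SiteL2K BondL2K covDerivL2K covDivL2K covLaplaceSiteK projR laplaceALatticeK RLatticeK)
open B9Eq310HessianOperator (adTransportW principalOpK covCurlL2K)
open B5Eq172FlatFibreNaturality (sum_norm_sq_coord coord_covCurlL2K_one coord_covDivL2K_one coord_QtorusW_one coord_RofU_one)

variable {d : ℕ}

/-! ## §5 The flat principal gauge-fixed form, fibre coordinate by fibre coordinate -/

section ThreeSquares

open B7Prop1Explicit (U1 Wcx boxVec)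
open B9Eq319QprimeTorus (fineP)
open B9Eq326OperatorAssembly (QprimeW RofU)
open B9Eq315QTorus (perCfg cornerSite QtorusW)
open B5Eq172HodgePositivity (hRS_one conj_inv_ofReal re_inner_principalOpK_one laplaceALatticeK_RLatticeK_eq re_inner_laplaceAK_projR)
open B11Eq103H1Complex (adjoint_covDerivL2K)

variable (L : ℕ) [NeZero L] (m : Fin d → ℕ) [∀ i, NeZero (fineP L m i)] (hL : 1 ≤ L) {c₀ c₁ : ℝ} [Fact (0 < c₀)] [Fact (0 < c₁)]
  {𝔸 : Type*} [NormedRing 𝔸] [NormedAlgebra ℂ 𝔸] [CompleteSpace 𝔸] [NormOneClass 𝔸]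
  {V : Type*} [NormedAddCommGroup V] [InnerProductSpace ℂ V] [FiniteDimensional ℂ V] (φ : V ≃ₗ[ℂ] 𝔸)
  {α : ℝ} (hα1 : α ≤ 1 / 64)
  (hU1 : ∀ (x : B7Prop1Explicit.Site d) (κ : Fin d), perCfg (fineP L m) (fun _ : Bond d (fineP L m) => (1 : 𝔸ˣ)) x κ ∈ U1 𝔸)
  (hreg : ∀ (y : TSite d m) (κ : Fin d) (r : Fin d → Fin L),
    ‖((Wcx L (perCfg (fineP L m) (fun _ : Bond d (fineP L m) => (1 : 𝔸ˣ))) (cornerSite L y) κ (boxVec L r) : 𝔸ˣ) : 𝔸) - 1‖ ≤ α)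
  (η a : ℝ)

/-- **(1.69) FOR THE CHAIN's FLAT OPERATOR — THREE SQUARES**: `re⟨x, (D*D + D R(1) D* + aQ(1)†Q(1)) x⟩ = ‖D(1)x‖² + ‖R(1)D*(1)x‖² + a‖Q(1)x‖²`
on the weighted carrier of `V`-valued bond functions, for any algebra reading `φ` and any flat regularity letters
(`B5Eq172HodgePositivity.re_inner_laplaceAK_projR` + `re_inner_principalOpK_one`, `D* = D†` at the flat transporters).
[cite: Balaban1984PropagatorsI, (1.69) p.29; Balaban1985BackgroundPropagators, (3.10) p.392, (3.26) p.395] -/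
theorem re_inner_flat_eq_three_sq (x : BondL2K ℂ d (fineP L m) c₀ V) :
    RCLike.re ⟪x, laplaceALatticeK ((η : ℂ))⁻¹ (adTransportW φ (fun _ : Bond d (fineP L m) => (1 : 𝔸ˣ)))
        (adTransportW φ fun _ : Bond d (fineP L m) => (1 : 𝔸ˣ)⁻¹) (principalOpK φ η fun _ => 1) (RofU L m φ η fun _ => 1)
        (QtorusW L m hL φ (fun _ => 1) hα1 hU1 hreg (c₁ := c₁)) a x⟫_ℂ =
      ‖covCurlL2K ℂ c₀ ((η : ℂ))⁻¹ (adTransportW φ (fun _ : Bond d (fineP L m) => (1 : 𝔸ˣ))) x‖ ^ 2 +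
        ‖RofU L m φ η (fun _ : Bond d (fineP L m) => (1 : 𝔸ˣ))
            (covDivL2K ℂ c₀ ((η : ℂ))⁻¹ (adTransportW φ fun _ : Bond d (fineP L m) => (1 : 𝔸ˣ)⁻¹) x)‖ ^ 2 +
          a * ‖QtorusW L m hL φ (fun _ => 1) hα1 hU1 hreg (c₁ := c₁) x‖ ^ 2 := by
  have hc : conj (((η : ℂ))⁻¹) = ((η : ℂ))⁻¹ := conj_inv_ofReal η
  have hRS := hRS_one (Pd := fineP L m) φ (𝔸 := 𝔸)
  unfold RofU
  rw [laplaceALatticeK_RLatticeK_eq _ hc _ _ hRS, re_inner_laplaceAK_projR, adjoint_covDerivL2K _ hc _ _ hRS, re_inner_principalOpK_one]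
  rfl

end ThreeSquares

section Reduction

open B7Prop1Explicit (U1 Wcx boxVec)
open B9Eq319QprimeTorus (fineP)
open B9Eq326OperatorAssembly (QprimeW RofU)
open B9Eq315QTorus (perCfg cornerSite QtorusW)

variable (L : ℕ) [NeZero L] (m : Fin d → ℕ) [∀ i, NeZero (fineP L m i)] (hL : 1 ≤ L) {c₀ c₁ : ℝ} [Fact (0 < c₀)] [Fact (0 < c₁)]
  {𝔸 : Type*} [NormedRing 𝔸] [NormedAlgebra ℂ 𝔸] [CompleteSpace 𝔸] [NormOneClass 𝔸]
  {W : Type*} [NormedAddCommGroup W] [InnerProductSpace ℂ W] [FiniteDimensional ℂ W] (φ : W ≃ₗ[ℂ] 𝔸)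
  {α : ℝ} (hα1 : α ≤ 1 / 64)
  (hU1 : ∀ (x : B7Prop1Explicit.Site d) (κ : Fin d), perCfg (fineP L m) (fun _ : Bond d (fineP L m) => (1 : 𝔸ˣ)) x κ ∈ U1 𝔸)
  (hreg : ∀ (y : TSite d m) (κ : Fin d) (r : Fin d → Fin L),
    ‖((Wcx L (perCfg (fineP L m) (fun _ : Bond d (fineP L m) => (1 : 𝔸ˣ))) (cornerSite L y) κ (boxVec L r) : 𝔸ˣ) : 𝔸) - 1‖ ≤ α)
  {α' : ℝ} (hα1' : α' ≤ 1 / 64)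
  (hU1' : ∀ (x : B7Prop1Explicit.Site d) (κ : Fin d), perCfg (fineP L m) (fun _ : Bond d (fineP L m) => (1 : ℂˣ)) x κ ∈ U1 ℂ)
  (hreg' : ∀ (y : TSite d m) (κ : Fin d) (r : Fin d → Fin L),
    ‖((Wcx L (perCfg (fineP L m) (fun _ : Bond d (fineP L m) => (1 : ℂˣ))) (cornerSite L y) κ (boxVec L r) : ℂˣ) : ℂ) - 1‖ ≤ α')
  (η a : ℝ)

/-- **THE FLAT PRINCIPAL GAUGE-FIXED FORM OF THE NE9 CHAIN, FIBRE COORDINATE BY FIBRE COORDINATE**: for an orthonormal basis `b` of the Hilbert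
fibre `W` and `x` a `W`-valued bond function with scalar coordinates `x_k = ⟨b_k, x(·)⟩`,
`re⟨x, (D*D + D R(1) D* + aQ(1)†Q(1))^{W,φ,𝔸} x⟩ = Σ_k re⟨x_k, (D*D + D R(1) D* + aQ(1)†Q(1))^{ℂ} x_k⟩` — the scalar side at `𝔸 = ℂ`,
`φ = refl` and any flat regularity letters (§5's three squares, Parseval §1, the naturality of `D(1)`, `D*(1)`, `Q(1)` §§2–3 and of `R(1)` §4).
[cite: Balaban1984PropagatorsI, (1.69) p.29, (1.72) p.30; Balaban1985BackgroundPropagators, (3.26) p.395] -/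
theorem re_inner_flat_eq_sum_coord {ι : Type*} [Fintype ι] (b : OrthonormalBasis ι ℂ W) (x : BondL2K ℂ d (fineP L m) c₀ W) :
    RCLike.re ⟪x, laplaceALatticeK ((η : ℂ))⁻¹ (adTransportW φ (fun _ : Bond d (fineP L m) => (1 : 𝔸ˣ)))
        (adTransportW φ fun _ : Bond d (fineP L m) => (1 : 𝔸ˣ)⁻¹) (principalOpK φ η fun _ => 1) (RofU L m φ η fun _ => 1)
        (QtorusW L m hL φ (fun _ => 1) hα1 hU1 hreg (c₁ := c₁)) a x⟫_ℂ =
      ∑ k, RCLike.re ⟪(WL2.equiv ℂ (fun _ : Bond d (fineP L m) => c₀) ℂ).symm (fun b' => ⟪b k, WL2.equiv ℂ _ W x b'⟫_ℂ),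
        laplaceALatticeK ((η : ℂ))⁻¹ (adTransportW (LinearEquiv.refl ℂ ℂ) (fun _ : Bond d (fineP L m) => (1 : ℂˣ)))
          (adTransportW (LinearEquiv.refl ℂ ℂ) fun _ : Bond d (fineP L m) => (1 : ℂˣ)⁻¹)
          (principalOpK (LinearEquiv.refl ℂ ℂ) η fun _ : Bond d (fineP L m) => (1 : ℂˣ))
          (RofU L m (LinearEquiv.refl ℂ ℂ) η (fun _ : Bond d (fineP L m) => (1 : ℂˣ)))
          (QtorusW L m hL (LinearEquiv.refl ℂ ℂ) (fun _ => 1) hα1' hU1' hreg' (c₁ := c₁)) a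
          ((WL2.equiv ℂ (fun _ : Bond d (fineP L m) => c₀) ℂ).symm (fun b' => ⟪b k, WL2.equiv ℂ _ W x b'⟫_ℂ))⟫_ℂ := by
  rw [re_inner_flat_eq_three_sq L m hL φ hα1 hU1 hreg η a x]
  simp_rw [re_inner_flat_eq_three_sq L m hL (LinearEquiv.refl ℂ ℂ) hα1' hU1' hreg' η a]
  rw [Finset.sum_add_distrib, Finset.sum_add_distrib, ← Finset.mul_sum]
  congr 2
  · -- the curl square
    rw [← sum_norm_sq_coord b (covCurlL2K ℂ c₀ ((η : ℂ))⁻¹ (adTransportW φ (fun _ : Bond d (fineP L m) => (1 : 𝔸ˣ))) x)]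
    refine Finset.sum_congr rfl fun k _ => ?_
    rw [coord_covCurlL2K_one L m φ ((η : ℂ))⁻¹ (b k) x]
  · -- the projected-divergence square
    rw [← sum_norm_sq_coord b (RofU L m φ η (fun _ : Bond d (fineP L m) => (1 : 𝔸ˣ))
      (covDivL2K ℂ c₀ ((η : ℂ))⁻¹ (adTransportW φ fun _ : Bond d (fineP L m) => (1 : 𝔸ˣ)⁻¹) x))]
    refine Finset.sum_congr rfl fun k _ => ?_
    rw [coord_RofU_one L m φ η (b k), coord_covDivL2K_one L m φ ((η : ℂ))⁻¹ (b k) x]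
  · -- the averaging square
    rw [← sum_norm_sq_coord b (QtorusW L m hL φ (fun _ => 1) hα1 hU1 hreg (c₁ := c₁) x)]
    refine Finset.sum_congr rfl fun k _ => ?_
    rw [coord_QtorusW_one L m hL φ hα1 hU1 hreg hα1' hU1' hreg' (b k) x]

/-- **A UNIFORM COERCIVITY CONSTANT OF THE SCALAR FLAT OPERATOR IS ONE FOR EVERY HILBERT FIBRE**: if `γ‖y‖² ≤ re⟨y, Δ_{1,a}(1)^{ℂ} y⟩` for all
scalar bond functions `y`, then `γ‖x‖² ≤ re⟨x, Δ_{1,a}(1)^{W,φ,𝔸} x⟩` for all `W`-valued `x` (Parseval over `stdOrthonormalBasis ℂ W`).  This is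
the reduction by which b05's UNIFORM (1.90) — a scalar statement on the b05 torus — reaches the `𝔤ᶜ`-valued chain.
[cite: Balaban1984PropagatorsI, (1.72) p.30, Prop. 1.1 (1.90) p.33; Balaban1985BackgroundPropagators, (3.26) p.395, Thm 3.11 p.416] -/
theorem coercive_of_scalar {γ : ℝ}
    (hγ : ∀ y : BondL2K ℂ d (fineP L m) c₀ ℂ, γ * ‖y‖ ^ 2 ≤
      RCLike.re ⟪y, laplaceALatticeK ((η : ℂ))⁻¹ (adTransportW (LinearEquiv.refl ℂ ℂ) (fun _ : Bond d (fineP L m) => (1 : ℂˣ)))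
          (adTransportW (LinearEquiv.refl ℂ ℂ) fun _ : Bond d (fineP L m) => (1 : ℂˣ)⁻¹)
          (principalOpK (LinearEquiv.refl ℂ ℂ) η fun _ : Bond d (fineP L m) => (1 : ℂˣ))
          (RofU L m (LinearEquiv.refl ℂ ℂ) η (fun _ : Bond d (fineP L m) => (1 : ℂˣ)))
          (QtorusW L m hL (LinearEquiv.refl ℂ ℂ) (fun _ => 1) hα1' hU1' hreg' (c₁ := c₁)) a y⟫_ℂ)
    (x : BondL2K ℂ d (fineP L m) c₀ W) :
    γ * ‖x‖ ^ 2 ≤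
      RCLike.re ⟪x, laplaceALatticeK ((η : ℂ))⁻¹ (adTransportW φ (fun _ : Bond d (fineP L m) => (1 : 𝔸ˣ)))
        (adTransportW φ fun _ : Bond d (fineP L m) => (1 : 𝔸ˣ)⁻¹) (principalOpK φ η fun _ => 1) (RofU L m φ η fun _ => 1)
        (QtorusW L m hL φ (fun _ => 1) hα1 hU1 hreg (c₁ := c₁)) a x⟫_ℂ := by
  rw [re_inner_flat_eq_sum_coord L m hL φ hα1 hU1 hreg hα1' hU1' hreg' η a (stdOrthonormalBasis ℂ W) x,
    ← sum_norm_sq_coord (stdOrthonormalBasis ℂ W) x, Finset.mul_sum]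
  exact Finset.sum_le_sum fun k _ => hγ _

end Reduction


/-! ## §6 [B5] Prop. 1.1 (1.90) for the NE9 chain's flat operator: the coercivity constant is VOLUME-FREE, for every Hilbert fibre -/

section B05

open B5Prop11Plancherel (Tor fine)

variable (L : ℕ) [NeZero L] (m : Fin d → ℕ) [∀ i, NeZero (m i)]

/-- **b05's UNIFORM (1.90) AS A FORM INEQUALITY**: `γ(d,a)·Σ_w ‖A w‖² ≤ re(star A ⬝ᵥ Δ_a A)` with `γ(d,a) = 1∕((d+1)·Cst d a)` — independent of `n`
and of the torus (`B5Prop11Lower.form_LapOne_le` + `B5DeltaA169.calDa_eq_DeltaA`, keeping the `V_none = 1` term of `Δ + 1`; print's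
«γ₀ independent of k, T_η»). [cite: Balaban1984PropagatorsI, Prop. 1.1 (1.90) p.33] -/
theorem b05_form_lower (hL : 1 ≤ L) {a : ℝ} (ha : 0 < a) (A : Tor (fine L m) × Fin d → ℂ) :
    (1 / ((d + 1 : ℝ) * B5Prop11Plancherel.Cst d a)) * ∑ w, ‖A w‖ ^ 2 ≤ (star A ⬝ᵥ (B5DeltaA169.DeltaA L m a).mulVec A).re := by
  have hC1 : (1 : ℝ) ≤ B5Prop11Plancherel.Cst d a := B5Prop11Lower.one_le_Cst a
  have hC : 0 < (d + 1 : ℝ) * B5Prop11Plancherel.Cst d a := by positivity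
  -- b05's key inequality, with `calDa = DeltaA`
  have h : ∑ α, B5Prop11Lower.nsq ((B5Prop11Lower.Vb L m α).mulVec A) ≤
      ((d + 1 : ℝ) * B5Prop11Plancherel.Cst d a) * (star A ⬝ᵥ (B5DeltaA169.DeltaA L m a).mulVec A).re := by
    have h0 := B5Prop11Lower.form_LapOne_le L hL m a ha A
    have hD := B5DeltaA169.calDa_eq_DeltaA L hL m a ha
    exact hD ▸ h0
  -- the `α = none` term of `Σ_α ‖V_α A‖²` is `Σ_w ‖A w‖²`
  have hnone : B5Prop11Lower.nsq ((B5Prop11Lower.Vb L m none).mulVec A) = ∑ w, ‖A w‖ ^ 2 := by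
    show B5Prop11Lower.nsq ((1 : Matrix (Tor (fine L m) × Fin d) (Tor (fine L m) × Fin d) ℂ).mulVec A) = _
    rw [Matrix.one_mulVec]
    rfl
  have hle : ∑ w, ‖A w‖ ^ 2 ≤ ∑ α, B5Prop11Lower.nsq ((B5Prop11Lower.Vb L m α).mulVec A) := by
    rw [← hnone]
    exact Finset.single_le_sum (f := fun α : Option (Fin d) => B5Prop11Lower.nsq ((B5Prop11Lower.Vb L m α).mulVec A))
      (fun α _ => B5Prop11Lower.nsq_nonneg _) (Finset.mem_univ none)
  have key := hle.trans h
  set F : ℝ := (star A ⬝ᵥ (B5DeltaA169.DeltaA L m a).mulVec A).re with hF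
  set S : ℝ := ∑ w, ‖A w‖ ^ 2 with hS
  set K : ℝ := (d + 1 : ℝ) * B5Prop11Plancherel.Cst d a with hK
  have : S / K ≤ F := by rw [div_le_iff₀ hC]; linarith
  calc 1 / K * S = S / K := by ring
    _ ≤ F := this

end B05

section Uniform

open B7Prop1Explicit (U1 Wcx boxVec)
open B9Eq319QprimeTorus (fineP)
open B9Eq326OperatorAssembly (RofU)
open B9Eq315QTorus (perCfg cornerSite QtorusW)
open B5Eq172FlatCoercivity (hU1_one hreg_one)
open B5Eq172HodgePositivity (coercive_of_sub_le)
open B9Eq315FlatDictionary (torCast_bijective)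
open B5Eq190FlatFormTransfer (re_inner_laplaceA_one_pullback norm_sq_pullback)
open B5Prop11Plancherel (Tor fine)
open B5Hk164Transl (cEnergy)

variable (L : ℕ) [NeZero L] (m : Fin d → ℕ) [∀ i, NeZero (m i)] [∀ i, NeZero (fineP L m i)] (hL : 1 ≤ L) {c₀ c₁ : ℝ} [Fact (0 < c₀)] [Fact (0 < c₁)]
  {𝔸 : Type*} [NormedRing 𝔸] [NormedAlgebra ℂ 𝔸] [CompleteSpace 𝔸] [NormOneClass 𝔸]
  {W : Type*} [NormedAddCommGroup W] [InnerProductSpace ℂ W] [FiniteDimensional ℂ W] (φ : W ≃ₗ[ℂ] 𝔸)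
  {α : ℝ} (hα1 : α ≤ 1 / 64)
  (hU1 : ∀ (x : B7Prop1Explicit.Site d) (κ : Fin d), perCfg (fineP L m) (fun _ : Bond d (fineP L m) => (1 : 𝔸ˣ)) x κ ∈ U1 𝔸)
  (hreg : ∀ (y : TSite d m) (κ : Fin d) (r : Fin d → Fin L),
    ‖((Wcx L (perCfg (fineP L m) (fun _ : Bond d (fineP L m) => (1 : 𝔸ˣ))) (cornerSite L y) κ (boxVec L r) : 𝔸ˣ) : 𝔸) - 1‖ ≤ α)
  {α' : ℝ} (hα1' : α' ≤ 1 / 64)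
  (hU1' : ∀ (x : B7Prop1Explicit.Site d) (κ : Fin d), perCfg (fineP L m) (fun _ : Bond d (fineP L m) => (1 : ℂˣ)) x κ ∈ U1 ℂ)
  (hreg' : ∀ (y : TSite d m) (κ : Fin d) (r : Fin d → Fin L),
    ‖((Wcx L (perCfg (fineP L m) (fun _ : Bond d (fineP L m) => (1 : ℂˣ))) (cornerSite L y) κ (boxVec L r) : ℂˣ) : ℂ) - 1‖ ≤ α')
  {η : ℝ} (hη : η ≠ 0) {a : ℝ} (ha : 0 < a)

include hη ha

/-- **THE FLAT COERCIVITY OF THE CHAIN ON SCALAR FIELDS WITH b05's UNIFORM CONSTANT** — `B5Eq172FlatCoercivity.exists_coercive_principal_flat`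
at `W = 𝔸 = ℂ` with its compactness witness REPLACED by (1.90): every scalar bond function `y` is a pull-back `A ∘ cast` along the site dictionary
(`B9Eq315FlatDictionary.torCast_bijective`); its flat form is `c₀(ηL)⁻²·re(star A ⬝ᵥ Δ_{a″} A)` by the three squares of (1.69)
(`B5Eq190FlatFormTransfer.re_inner_laplaceA_one_pullback`, `a″ = a·c₁·(ηL)²∕(c₀·L^d)`), its norm `c₀·Σ‖A w‖²` (`norm_sq_pullback`), and
`b05_form_lower` gives `(γ(d,a″)∕(ηL)²)·‖y‖² ≤ re⟨y, (D*D + D R(1) D* + aQ(1)†Q(1))^{ℂ} y⟩` — NO dependence on the volume `m`.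
[cite: Balaban1984PropagatorsI, Prop. 1.1 (1.90) p.33, (1.69) p.29; Balaban1985BackgroundPropagators, (3.26) p.395, Thm 3.11 p.416] -/
theorem flat_coercive_scalar (y : BondL2K ℂ d (fineP L m) c₀ ℂ) :
    (1 / ((d + 1 : ℝ) * B5Prop11Plancherel.Cst d (a * c₁ * (η * L) ^ 2 / (c₀ * (L : ℝ) ^ d)))) * ((η * L)⁻¹) ^ 2 * ‖y‖ ^ 2 ≤
      RCLike.re ⟪y, laplaceALatticeK ((η : ℂ))⁻¹ (adTransportW (LinearEquiv.refl ℂ ℂ) (fun _ : Bond d (fineP L m) => (1 : ℂˣ)))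
          (adTransportW (LinearEquiv.refl ℂ ℂ) fun _ : Bond d (fineP L m) => (1 : ℂˣ)⁻¹)
          (principalOpK (LinearEquiv.refl ℂ ℂ) η fun _ : Bond d (fineP L m) => (1 : ℂˣ))
          (RofU L m (LinearEquiv.refl ℂ ℂ) η (fun _ : Bond d (fineP L m) => (1 : ℂˣ)))
          (B9Eq315QTorus.QtorusW L m hL (LinearEquiv.refl ℂ ℂ) (fun _ => 1) hα1' hU1' hreg' (c₁ := c₁)) a y⟫_ℂ := by
  have hc₀ : 0 < c₀ := Fact.out
  have hc₁ : 0 < c₁ := Fact.out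
  have hLr : (0 : ℝ) < L := by exact_mod_cast Nat.pos_of_ne_zero (NeZero.ne L)
  have hηL : 0 < (η * L) ^ 2 := by positivity
  -- every scalar bond function is a pull-back along the site dictionary
  set A : Tor (fine L m) × Fin d → ℂ :=
    fun w => WL2.equiv ℂ _ ℂ y (Function.surjInv (torCast_bijective (fineP L m)).surjective w.1, w.2) with hA
  have hy : (WL2.linearEquiv ℂ ℂ (fun _ : Bond d (fineP L m) => c₀)).symm
      (fun b => A (fun i => ((b.1 i : ℕ) : ZMod (fineP L m i)), b.2)) = y := by
    apply (WL2.equiv ℂ (fun _ : Bond d (fineP L m) => c₀) ℂ).injective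
    funext b
    rw [WL2.linearEquiv_symm_apply, Equiv.apply_symm_apply, hA]
    dsimp only
    rw [Function.leftInverse_surjInv (torCast_bijective (fineP L m)) b.1]
  -- the chain's form of a pull-back is `c₀(ηL)⁻²·re(star A ⬝ Δ_{a″} A)` (the three squares of (1.69), `B5Eq190FlatFormTransfer`)
  set a'' : ℝ := a * c₁ * (η * L) ^ 2 / (c₀ * (L : ℝ) ^ d) with ha''
  have ha''pos : 0 < a'' := by positivity
  rw [← hy, re_inner_laplaceA_one_pullback L m hL hα1' hU1' hreg' hη a A, norm_sq_pullback]
  have hform : c₀ * ((η * L)⁻¹) ^ 2 * cEnergy L m A + c₀ * ((η * L)⁻¹) ^ 2 * ∑ z, ‖B5Hk164Transl.RdivS L m A z‖ ^ 2 +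
        a * (c₁ * ∑ w : Tor m × Fin d, ‖(B5Block118.QvOp L m).mulVec A w‖ ^ 2) =
      c₀ * ((η * L)⁻¹) ^ 2 * (star A ⬝ᵥ (B5DeltaA169.DeltaA L m a'').mulVec A).re := by
    rw [B5Hk164Transl.re_form_DeltaA, ha'']
    field_simp
  rw [hform]
  -- b05's uniform (1.90) at `a″`
  have hb := b05_form_lower L m hL ha''pos A
  have hpos : 0 ≤ c₀ * ((η * L)⁻¹) ^ 2 := by positivity
  calc 1 / ((d + 1 : ℝ) * B5Prop11Plancherel.Cst d a'') * (η * ↑L)⁻¹ ^ 2 * (c₀ * ∑ w, ‖A w‖ ^ 2)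
      = c₀ * ((η * L)⁻¹) ^ 2 * (1 / ((d + 1 : ℝ) * B5Prop11Plancherel.Cst d a'') * ∑ w, ‖A w‖ ^ 2) := by ring
    _ ≤ c₀ * ((η * L)⁻¹) ^ 2 * (star A ⬝ᵥ (B5DeltaA169.DeltaA L m a'').mulVec A).re := mul_le_mul_of_nonneg_left hb hpos

end Uniform

section Fibre

open B7Prop1Explicit (U1 Wcx boxVec)
open B9Eq319QprimeTorus (fineP)
open B9Eq326OperatorAssembly (RofU)
open B9Eq315QTorus (perCfg cornerSite QtorusW)
open B5Eq172FlatCoercivity (hU1_one hreg_one)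
open B5Eq172HodgePositivity (coercive_of_sub_le)

variable (L : ℕ) [NeZero L] (m : Fin d → ℕ) [∀ i, NeZero (fineP L m i)] (hL : 1 ≤ L) {c₀ c₁ : ℝ} [Fact (0 < c₀)] [Fact (0 < c₁)]
  {𝔸 : Type*} [NormedRing 𝔸] [NormedAlgebra ℂ 𝔸] [CompleteSpace 𝔸] [NormOneClass 𝔸]
  {W : Type*} [NormedAddCommGroup W] [InnerProductSpace ℂ W] [FiniteDimensional ℂ W] (φ : W ≃ₗ[ℂ] 𝔸)
  {α : ℝ} (hα1 : α ≤ 1 / 64)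
  (hU1 : ∀ (x : B7Prop1Explicit.Site d) (κ : Fin d), perCfg (fineP L m) (fun _ : Bond d (fineP L m) => (1 : 𝔸ˣ)) x κ ∈ U1 𝔸)
  (hreg : ∀ (y : TSite d m) (κ : Fin d) (r : Fin d → Fin L),
    ‖((Wcx L (perCfg (fineP L m) (fun _ : Bond d (fineP L m) => (1 : 𝔸ˣ))) (cornerSite L y) κ (boxVec L r) : 𝔸ˣ) : 𝔸) - 1‖ ≤ α)
  {η : ℝ} (hη : η ≠ 0) {a : ℝ} (ha : 0 < a)

include hη ha

/-- **[B5] PROP. 1.1 (1.90) FOR THE NE9 CHAIN's FLAT PRINCIPAL GAUGE-FIXED OPERATOR ON `𝔤ᶜ`-VALUED FIELDS — THE COERCIVITY CONSTANT IS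
VOLUME-FREE**: for every finite-dimensional Hilbert fibre `W`, every algebra reading `φ : W ≃ 𝔸`, every flat regularity letter, every volume `m`:
`(γ(d,a″)∕(ηL)²)·‖x‖² ≤ re⟨x, (D*D + D R(1) D* + aQ(1)†Q(1)) x⟩` with `a″ = a·c₁·(ηL)²∕(c₀·L^d)`, `γ(d,a) = 1∕((d+1)·B5Prop11Plancherel.Cst d a)` —
`B5Eq172FlatCoercivity.exists_coercive_principal_flat` with its compactness witness REPLACED by b05's uniform constant (scalar transfer
`B5Eq190FlatFormTransfer` + fibre reduction `B5Eq172FlatFibreNaturality` ∕ §5).  The constant depends on `d, L, η, a, c₀, c₁` only.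
[cite: Balaban1984PropagatorsI, Prop. 1.1 (1.90) p.33, (1.72) p.30; Balaban1985BackgroundPropagators, (3.26) p.395, Thm 3.11 p.416] -/
theorem flat_coercive_uniform (x : BondL2K ℂ d (fineP L m) c₀ W) :
    (1 / ((d + 1 : ℝ) * B5Prop11Plancherel.Cst d (a * c₁ * (η * L) ^ 2 / (c₀ * (L : ℝ) ^ d)))) * ((η * L)⁻¹) ^ 2 * ‖x‖ ^ 2 ≤
      RCLike.re ⟪x, laplaceALatticeK ((η : ℂ))⁻¹ (adTransportW φ (fun _ : Bond d (fineP L m) => (1 : 𝔸ˣ)))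
        (adTransportW φ fun _ : Bond d (fineP L m) => (1 : 𝔸ˣ)⁻¹) (principalOpK φ η fun _ => 1) (RofU L m φ η fun _ => 1)
        (QtorusW L m hL φ (fun _ => 1) hα1 hU1 hreg (c₁ := c₁)) a x⟫_ℂ := by
  -- `L·m_i ≠ 0 ⇒ m_i ≠ 0` (the b05 torus `Tor (fine L m)` of the scalar transfer needs it; the statement does not)
  haveI : ∀ i, NeZero (m i) := fun i => ⟨right_ne_zero_of_mul (NeZero.ne (fineP L m i))⟩
  exact coercive_of_scalar L m hL φ hα1 hU1 hreg (show (0 : ℝ) ≤ 1 / 64 by norm_num) (hU1_one L m) (hreg_one L m) η a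
    (flat_coercive_scalar L m hL (show (0 : ℝ) ≤ 1 / 64 by norm_num) (hU1_one L m) (hreg_one L m) hη ha) x

omit [Fact (0 < c₀)] [Fact (0 < c₁)] ha in
/-- The volume-free constant is positive. [cite: Balaban1984PropagatorsI, Prop. 1.1 (1.90) p.33] -/
theorem flatConst_pos :
    0 < (1 / ((d + 1 : ℝ) * B5Prop11Plancherel.Cst d (a * c₁ * (η * L) ^ 2 / (c₀ * (L : ℝ) ^ d)))) * ((η * L)⁻¹) ^ 2 := by
  have hC : (1 : ℝ) ≤ B5Prop11Plancherel.Cst d (a * c₁ * (η * L) ^ 2 / (c₀ * (L : ℝ) ^ d)) := B5Prop11Lower.one_le_Cst _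
  have hL0 : (0 : ℝ) < L := by exact_mod_cast Nat.pos_of_ne_zero (NeZero.ne L)
  have hηL : 0 < ((η * L)⁻¹) ^ 2 := by positivity
  have hK : 0 < (d + 1 : ℝ) * B5Prop11Plancherel.Cst d (a * c₁ * (η * L) ^ 2 / (c₀ * (L : ℝ) ^ d)) := by positivity
  positivity

/-- **`B5Eq172FlatCoercivity.exists_coercive_principal_flat₀` WITH THE VOLUME QUANTIFIED INSIDE** (`α := 0`, the two flat background letters
supplied): ONE `γ > 0` — the constant of `flat_coercive_uniform` — serves every volume `m` (and every fibre reading). [cite: Balaban1984PropagatorsI, Prop. 1.1 (1.90) p.33, (1.72) p.30; Balaban1985BackgroundPropagators, Thm 3.11 p.416] -/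
theorem exists_coercive_principal_flat_uniform :
    ∃ γ : ℝ, 0 < γ ∧ ∀ (m : Fin d → ℕ) [∀ i, NeZero (fineP L m i)] (x : BondL2K ℂ d (fineP L m) c₀ W), γ * ‖x‖ ^ 2 ≤
      RCLike.re ⟪x, laplaceALatticeK ((η : ℂ))⁻¹ (adTransportW φ (fun _ : Bond d (fineP L m) => (1 : 𝔸ˣ)))
        (adTransportW φ fun _ : Bond d (fineP L m) => (1 : 𝔸ˣ)⁻¹) (principalOpK φ η fun _ => 1) (RofU L m φ η fun _ => 1)
        (QtorusW L m hL φ (fun _ => 1) (show (0 : ℝ) ≤ 1 / 64 by norm_num) (hU1_one L m) (hreg_one L m) (c₁ := c₁)) a x⟫_ℂ :=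
  ⟨_, flatConst_pos L (d := d) (c₀ := c₀) (c₁ := c₁) (a := a) hη,
    fun m _ x => flat_coercive_uniform L m hL φ _ (hU1_one L m) (hreg_one L m) hη ha x⟩

/-- **[B9] THM 3.11's SECOND HALF AT A BACKGROUND NEAR THE FLAT ONE, WITH THE VOLUME-FREE FLAT CONSTANT** — the shape
`B5Eq172FlatCoercivity.exists_coercive_principal_of_near_flat` consumed by the NE9 owner's `B9Thm311SmallFieldCoercivity` (its `γ₀`), now with
`γ₀ = γ(d,a″)∕(ηL)²` EXPLICIT: whenever `‖(Δ_prin(U) − Δ_prin(1))x‖ ≤ δ‖x‖`, `(γ₀ − δ)‖x‖² ≤ re⟨x, Δ_prin(U)x⟩`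
(`B5Eq172HodgePositivity.coercive_of_sub_le`).  The closeness `δ` is the DISPLAYED input, as there.
[cite: Balaban1985BackgroundPropagators, Thm 3.11 p.416, (3.86) p.409; Balaban1984PropagatorsI, Prop. 1.1 (1.90) p.33, (1.72) p.30] -/
theorem coercive_principal_of_near_flat_uniform (δ : ℝ) (U : Bond d (fineP L m) → 𝔸ˣ) {αU : ℝ} (hαU : αU ≤ 1 / 64)
    (hU1U : ∀ (x : B7Prop1Explicit.Site d) (κ : Fin d), perCfg (fineP L m) U x κ ∈ U1 𝔸)
    (hregU : ∀ (y : TSite d m) (κ : Fin d) (r : Fin d → Fin L), ‖((Wcx L (perCfg (fineP L m) U) (cornerSite L y) κ (boxVec L r) : 𝔸ˣ) : 𝔸) - 1‖ ≤ αU)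
    (hnear : ∀ x : BondL2K ℂ d (fineP L m) c₀ W,
      ‖laplaceALatticeK ((η : ℂ))⁻¹ (adTransportW φ U) (adTransportW φ fun b => (U b)⁻¹) (principalOpK φ η U) (RofU L m φ η U)
          (QtorusW L m hL φ U hαU hU1U hregU (c₁ := c₁)) a x -
        laplaceALatticeK ((η : ℂ))⁻¹ (adTransportW φ (fun _ : Bond d (fineP L m) => (1 : 𝔸ˣ)))
          (adTransportW φ fun _ : Bond d (fineP L m) => (1 : 𝔸ˣ)⁻¹) (principalOpK φ η fun _ => 1) (RofU L m φ η fun _ => 1)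
          (QtorusW L m hL φ (fun _ => 1) (show (0 : ℝ) ≤ 1 / 64 by norm_num) (hU1_one L m) (hreg_one L m) (c₁ := c₁)) a x‖ ≤ δ * ‖x‖)
    (x : BondL2K ℂ d (fineP L m) c₀ W) :
    ((1 / ((d + 1 : ℝ) * B5Prop11Plancherel.Cst d (a * c₁ * (η * L) ^ 2 / (c₀ * (L : ℝ) ^ d)))) * ((η * L)⁻¹) ^ 2 - δ) * ‖x‖ ^ 2 ≤
      RCLike.re ⟪x, laplaceALatticeK ((η : ℂ))⁻¹ (adTransportW φ U) (adTransportW φ fun b => (U b)⁻¹) (principalOpK φ η U) (RofU L m φ η U)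
        (QtorusW L m hL φ U hαU hU1U hregU (c₁ := c₁)) a x⟫_ℂ :=
  coercive_of_sub_le (flat_coercive_uniform L m hL φ (show (0 : ℝ) ≤ 1 / 64 by norm_num) (hU1_one L m) (hreg_one L m) hη ha) hnear x

end Fibre

end Literature.MathematicalPhysics.QuantumFieldTheory.Balaban1983to89.B5Eq190FlatCoercivityUniform

end
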